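import Literature.Analysis.FunctionSpaces.BesovSliceMeasurability
import Literature.Analysis.FluidPDE.DuchonRobertShellLaw
import Literature.Analysis.FluidPDE.MollifiedLimits
import Literature.Analysis.FunctionSpaces.TorusMollifier
import HarnessLib

/-!
# Continuity of spatial translation and convergence of ball averages in `L^q((0,T) × T^d)`

Topic: Analysis/FluidPDE (torus tools, next to the translation lemmas of
`Literature.Analysis.FluidPDE.DuchonRobertShellLaw`). Two standard facts for a jointly measurable
space–time field `u : ℝ → T^d → F` with `∫₀ᵀ∫ ‖u‖^q < ∞`, `1 ≤ q < ∞`, both **proved**: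

* `Torus.tendsto_lintegral_translate_sub` — **continuity of spatial translation**:
  `∫₀ᵀ∫ ‖u(t, x + h) − u(t, x)‖^q dx dt → 0` as `h → 0` in `T^d`; slice-wise this is the
  continuity of translation in `L^q(T^d)` (Rudin, *Real and Complex Analysis*, Thm. 9.5; the
  tree's `FunctionSpaces.continuous_eLpNorm_comp_add_sub`, from Mathlib's
  `Lp.compMeasurePreserving_continuous`), lifted to space–time by dominated convergence in time
  (domination `‖a − b‖^q ≤ 2^{q−1}(‖a‖^q + ‖b‖^q)` and translation invariance of Haar measure).
* `Torus.tendsto_lintegral_ballAverage_sub` — **ball averages converge in the mean**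
  (Lebesgue's differentiation theorem in `L^q`; Folland, *Real Analysis*, Thm. 8.14 (a) for the
  normalised indicator of the ball): `∫₀ᵀ∫ ‖⨍_{B_ℓ} u(t, x + y) dy − u(t, x)‖^q dx dt → 0` as
  `ℓ → 0⁺`, the separation `y ∈ ℝ^d` acting through the covering map `proj` — Jensen on each
  ball (`Torus.enorm_setAverage_rpow_le`), Tonelli on `((0,T) × T^d) × B_ℓ`, and the first fact
  (`‖proj y‖ ≤ ‖y‖ < ℓ`); with the companions `Torus.aestronglyMeasurable_ballAverage` (joint
  measurability of the ball average) and `Torus.lintegral_ballAverage_rpow_le`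
  (`∫₀ᵀ∫ ‖⨍_{B_ℓ} u(t, x + y) dy‖^q ≤ ∫₀ᵀ∫ ‖u‖^q`, Young's inequality for the unit-mass kernel).

The second fact is the analytic input of the scale-`ℓ → 0` limits in Novack 2024, Thm. 1
(the ball averages `Torus.ballAvg` of `Literature.Analysis.FluidPDE.NovackBallAvgBalance` are
literally `⨍ y in ball 0 ℓ, u (x + proj y)`).

## References

* W. Rudin, *Real and Complex Analysis*, 3rd ed., Thm. 9.5 (continuity of translation in
  `L^p`). [folklore]
* G. B. Folland, *Real Analysis*, 2nd ed., Prop. 8.5 and Thm. 8.14 (a). [Folland1999]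
* Mathlib: `MeasureTheory.Lp.compMeasurePreserving_continuous`,
  `tendsto_lintegral_filter_of_dominated_convergence'`, `lintegral_lintegral_swap`; tree:
  `Torus.aestronglyMeasurable_translate`, `Torus.lintegral_mul_translate_enorm_pow`
  (`DuchonRobertShellLaw`), `lintegral_mul_rpow_le_of_unit_mass` (`MollifiedLimits`).
-/

noncomputable section

open MeasureTheory TopologicalSpace Set Function Filter Metric
open _root_.Topology
open scoped ENNReal NNReal

namespace Literature.Analysis.FluidPDE.Torus

variable {d : Type*} [Fintype d] {F : Type*} [NormedAddCommGroup F]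

/-- The `q`-th power (`q > 0` real) of the `L^q` seminorm with exponent `ENNReal.ofReal q` is the
lower integral `∫⁻ ‖f‖ₑ^q`. [folklore] -/
theorem lintegral_enorm_rpow_eq_eLpNorm_rpow {α : Type*} [MeasurableSpace α] {μ : Measure α}
    {f : α → F} {q : ℝ} (hq : 0 < q) :
    ∫⁻ x, ‖f x‖ₑ ^ q ∂μ = eLpNorm f (ENNReal.ofReal q) μ ^ q := by
  have hp0 : ENNReal.ofReal q ≠ 0 := by simpa using hq
  rw [eLpNorm_eq_eLpNorm' hp0 ENNReal.ofReal_ne_top, ENNReal.toReal_ofReal hq.le,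
    lintegral_rpow_enorm_eq_rpow_eLpNorm' hq]

/-- **Continuity of translation in `L^q(T^d)`, lower-integral form**: for `g ∈ L^q(T^d)`,
`1 ≤ q < ∞`, `∫ ‖g(x + h) − g(x)‖^q dx → 0` as `h → 0` (Rudin, Thm. 9.5). [folklore] -/
theorem tendsto_lintegral_comp_add_sub {q : ℝ} (hq : 1 ≤ q) {g : UnitAddTorus d → F}
    (hg : MemLp g (ENNReal.ofReal q) volume) :
    Tendsto (fun h : UnitAddTorus d => ∫⁻ x, ‖g (x + h) - g x‖ₑ ^ q) (𝓝 0) (𝓝 0) := by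
  have hq0 : 0 < q := one_pos.trans_le hq
  have hp1 : (1 : ℝ≥0∞) ≤ ENNReal.ofReal q := by
    rw [← ENNReal.ofReal_one]; exact ENNReal.ofReal_le_ofReal hq
  have hc := FunctionSpaces.continuous_eLpNorm_comp_add_sub hp1 ENNReal.ofReal_ne_top hg
  have h0 : eLpNorm (fun x => g (x + 0) - g x) (ENNReal.ofReal q) volume = 0 := by simp
  have ht : Tendsto (fun h : UnitAddTorus d => eLpNorm (fun x => g (x + h) - g x) (ENNReal.ofReal q) volume)
      (𝓝 0) (𝓝 0) := by
    simpa only [h0] using hc.tendsto 0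
  have hpow := ((ENNReal.continuous_rpow_const (y := q)).tendsto 0).comp ht
  rw [ENNReal.zero_rpow_of_pos hq0] at hpow
  refine hpow.congr fun h => ?_
  simp only [Function.comp_def]
  rw [lintegral_enorm_rpow_eq_eLpNorm_rpow hq0]

/-- The elementary domination `‖a − b‖^q ≤ 2^{q−1}(‖a‖^q + ‖b‖^q)` (`q ≥ 1`), in `ℝ≥0∞`. [folklore] -/
theorem enorm_sub_rpow_le {a b : F} {q : ℝ} (hq : 1 ≤ q) :
    ‖a - b‖ₑ ^ q ≤ (2 : ℝ≥0∞) ^ (q - 1) * (‖a‖ₑ ^ q + ‖b‖ₑ ^ q) := by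
  calc ‖a - b‖ₑ ^ q ≤ (‖a‖ₑ + ‖b‖ₑ) ^ q := by
        gcongr
        exact enorm_sub_le
    _ ≤ (2 : ℝ≥0∞) ^ (q - 1) * (‖a‖ₑ ^ q + ‖b‖ₑ ^ q) := ENNReal.rpow_add_le_mul_rpow_add_rpow _ _ hq

section SpaceTime

variable {T : ℝ} {u : ℝ → UnitAddTorus d → F}

/-- Slices of a jointly measurable field are a.e.-strongly measurable for a.e. time. [folklore] -/
theorem ae_aestronglyMeasurable_slice
    (hu : AEStronglyMeasurable (uncurry u) ((volume.restrict (Ioo 0 T)).prod volume)) :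
    ∀ᵐ t ∂(volume.restrict (Ioo 0 T)), AEStronglyMeasurable (u t) volume :=
  hu.prodMk_left

/-- For a jointly measurable field with `∫₀ᵀ∫ ‖u‖^q < ∞`, a.e. slice lies in `L^q(T^d)`. [folklore] -/
theorem ae_memLp_slice {q : ℝ} (hq : 0 < q)
    (hu : AEStronglyMeasurable (uncurry u) ((volume.restrict (Ioo 0 T)).prod volume))
    (huq : ∫⁻ t in Ioo 0 T, ∫⁻ x, ‖u t x‖ₑ ^ q < ∞) :
    ∀ᵐ t ∂(volume.restrict (Ioo 0 T)), MemLp (u t) (ENNReal.ofReal q) volume := by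
  have hmeas : AEMeasurable (fun t => ∫⁻ x, ‖u t x‖ₑ ^ q) (volume.restrict (Ioo 0 T)) :=
    (hu.enorm.pow_const q).lintegral_prod_right'
  have hfin : ∀ᵐ t ∂(volume.restrict (Ioo 0 T)), ∫⁻ x, ‖u t x‖ₑ ^ q < ∞ :=
    ae_lt_top' hmeas huq.ne
  filter_upwards [ae_aestronglyMeasurable_slice hu, hfin] with t ht hft
  refine ⟨ht, ?_⟩
  rw [← ENNReal.rpow_lt_top_iff_of_pos hq, ← lintegral_enorm_rpow_eq_eLpNorm_rpow hq]
  exact hft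

/-- The translated field `(t, x) ↦ u t (x + h)` is jointly a.e.-strongly measurable. [folklore] -/
theorem aestronglyMeasurable_uncurry_comp_add
    (hu : AEStronglyMeasurable (uncurry u) ((volume.restrict (Ioo 0 T)).prod volume))
    (h : UnitAddTorus d) :
    AEStronglyMeasurable (uncurry fun t x => u t (x + h)) ((volume.restrict (Ioo 0 T)).prod volume) := by
  have hmp : MeasurePreserving (Prod.map id fun x : UnitAddTorus d => x + h)
      ((volume.restrict (Ioo 0 T)).prod volume) ((volume.restrict (Ioo 0 T)).prod volume) :=
    (MeasurePreserving.id _).prod (measurePreserving_add_right volume h)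
  exact hu.comp_measurePreserving hmp

/-- **Continuity of spatial translation in `L^q((0,T) × T^d)`**: for a jointly measurable field
`u` with `∫₀ᵀ∫ ‖u‖^q < ∞`, `1 ≤ q`, `∫₀ᵀ∫ ‖u(t, x + h) − u(t, x)‖^q dx dt → 0` as `h → 0`
(slice-wise Rudin, Thm. 9.5, and dominated convergence in time with the domination
`2^{q−1}(‖u(t,·+h)‖_q^q + ‖u(t)‖_q^q) = 2^q ‖u(t)‖_q^q`). [folklore] -/
theorem tendsto_lintegral_translate_sub {q : ℝ} (hq : 1 ≤ q)
    (hu : AEStronglyMeasurable (uncurry u) ((volume.restrict (Ioo 0 T)).prod volume))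
    (huq : ∫⁻ t in Ioo 0 T, ∫⁻ x, ‖u t x‖ₑ ^ q < ∞) :
    Tendsto (fun h : UnitAddTorus d => ∫⁻ t in Ioo 0 T, ∫⁻ x, ‖u t (x + h) - u t x‖ₑ ^ q)
      (𝓝 0) (𝓝 0) := by
  have hq0 : 0 < q := one_pos.trans_le hq
  set μt : Measure ℝ := volume.restrict (Ioo 0 T) with hμt
  set bound : ℝ → ℝ≥0∞ := fun t => (2 : ℝ≥0∞) ^ (q - 1) * (2 * ∫⁻ x, ‖u t x‖ₑ ^ q) with hbound
  have h0 : (∫⁻ _ : ℝ, (0 : ℝ≥0∞) ∂μt) = 0 := lintegral_zero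
  rw [← h0]
  refine tendsto_lintegral_filter_of_dominated_convergence' bound ?_ ?_ ?_ ?_
  · -- measurability of the sections in time
    refine Eventually.of_forall fun h => ?_
    have hm : AEStronglyMeasurable (uncurry fun t x => u t (x + h) - u t x) (μt.prod volume) :=
      (aestronglyMeasurable_uncurry_comp_add hu h).sub hu
    exact (hm.enorm.pow_const q).lintegral_prod_right'
  · -- domination, for a.e. `t` (slices measurable)
    refine Eventually.of_forall fun h => ?_
    filter_upwards [ae_aestronglyMeasurable_slice hu] with t ht
    have h1 : ∫⁻ x, ‖u t (x + h) - u t x‖ₑ ^ q ≤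
        ∫⁻ x, (2 : ℝ≥0∞) ^ (q - 1) * (‖u t (x + h)‖ₑ ^ q + ‖u t x‖ₑ ^ q) :=
      lintegral_mono fun x => enorm_sub_rpow_le hq
    refine h1.trans (le_of_eq ?_)
    have hmq : AEMeasurable (fun x => ‖u t x‖ₑ ^ q) volume := ht.enorm.pow_const q
    have hmqh : AEMeasurable (fun x => ‖u t (x + h)‖ₑ ^ q) volume :=
      ((ht.comp_quasiMeasurePreserving
        (measurePreserving_add_right volume h).quasiMeasurePreserving).enorm.pow_const q)
    have hsum : AEMeasurable (fun x => ‖u t (x + h)‖ₑ ^ q + ‖u t x‖ₑ ^ q) volume := hmqh.add hmq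
    rw [lintegral_const_mul'' _ hsum, lintegral_add_right' _ hmq,
      lintegral_add_right_eq_self (fun x => ‖u t x‖ₑ ^ q) h, ← two_mul]
  · -- the domination is integrable in time
    have hmeas : AEMeasurable (fun t => ∫⁻ x, ‖u t x‖ₑ ^ q) μt :=
      (hu.enorm.pow_const q).lintegral_prod_right'
    have : ∫⁻ t, bound t ∂μt = (2 : ℝ≥0∞) ^ (q - 1) * (2 * ∫⁻ t, (∫⁻ x, ‖u t x‖ₑ ^ q) ∂μt) := by
      rw [hbound, lintegral_const_mul'' _ (hmeas.const_mul 2), lintegral_const_mul'' _ hmeas]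
    rw [this]
    refine ENNReal.mul_ne_top (ENNReal.rpow_ne_top_of_nonneg (by linarith) ENNReal.ofNat_ne_top)
      (ENNReal.mul_ne_top ENNReal.ofNat_ne_top huq.ne)
  · -- slice-wise convergence
    filter_upwards [ae_memLp_slice hq0 hu huq] with t ht
    exact tendsto_lintegral_comp_add_sub hq ht

end SpaceTime

/-! ## Ball averages through the covering map converge in `L^q` -/

section BallAverage

variable [NormedSpace ℝ F]

/-- **Jensen for ball averages, pointwise**: if `y ↦ G y` has an a.e.-strongly measurable
section on the ball `B` (finite nonzero volume), then
`‖⨍_B G‖ₑ^q ≤ |B|⁻¹ ∫⁻_B ‖G‖ₑ^q` for `q ≥ 1` (monotonicity of `L^p` norms on the probability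
space `|B|⁻¹ dy|_B`). [folklore] -/
theorem enorm_setAverage_rpow_le {s : Set (EuclideanSpace ℝ d)} (hs0 : volume s ≠ 0)
    (hs : volume s ≠ ∞) {G : EuclideanSpace ℝ d → F}
    (hG : AEStronglyMeasurable G (volume.restrict s)) {q : ℝ} (hq : 1 ≤ q) :
    ‖⨍ y in s, G y‖ₑ ^ q ≤ (volume s)⁻¹ * ∫⁻ y in s, ‖G y‖ₑ ^ q := by
  have hq0 : 0 < q := one_pos.trans_le hq
  set c : ℝ := (volume.real s)⁻¹ with hc
  have hcpos : 0 < volume.real s := ENNReal.toReal_pos hs0 hs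
  have hce : ‖c‖ₑ = (volume s)⁻¹ := by
    rw [hc, Real.enorm_eq_ofReal (inv_nonneg.2 hcpos.le), ENNReal.ofReal_inv_of_pos hcpos,
      measureReal_def, ENNReal.ofReal_toReal hs]
  -- `k = c` is a unit-mass kernel on `s`
  have hk1 : ∫⁻ _ in s, ‖c‖ₑ = 1 := by
    rw [setLIntegral_const, hce, ENNReal.inv_mul_cancel hs0 hs]
  have hJ := lintegral_mul_rpow_le_of_unit_mass (μ := volume.restrict s) (k := fun _ => c)
    (fun _ => inv_nonneg.2 hcpos.le) measurable_const hk1 (g := fun y => ‖G y‖ₑ) hG.enorm hq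
  have h1 : ‖⨍ y in s, G y‖ₑ ≤ ∫⁻ y in s, ‖c‖ₑ * ‖G y‖ₑ := by
    rw [setAverage_eq, enorm_smul, ← hc, lintegral_const_mul' _ _ (by rw [hce]; exact ENNReal.inv_ne_top.2 hs0)]
    gcongr
    exact enorm_integral_le_lintegral_enorm _
  calc ‖⨍ y in s, G y‖ₑ ^ q ≤ (∫⁻ y in s, ‖c‖ₑ * ‖G y‖ₑ) ^ q := by gcongr
    _ ≤ ∫⁻ y in s, ‖c‖ₑ * ‖G y‖ₑ ^ q := hJ
    _ = (volume s)⁻¹ * ∫⁻ y in s, ‖G y‖ₑ ^ q := by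
        rw [lintegral_const_mul' _ _ (by rw [hce]; exact ENNReal.inv_ne_top.2 hs0), hce]

variable {T : ℝ} {u : ℝ → UnitAddTorus d → F}

omit [NormedSpace ℝ F] in
/-- The increment field `((t,x), y) ↦ u t (x + proj y) − u t x` of a jointly measurable field is
jointly a.e.-strongly measurable on `((0,T) × T^d) × ℝ^d` (any s-finite measure in `y`). [folklore] -/
theorem aestronglyMeasurable_increment_proj (ν : Measure (EuclideanSpace ℝ d)) [SFinite ν]
    (hu : AEStronglyMeasurable (uncurry u) ((volume.restrict (Ioo 0 T)).prod volume)) :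
    AEStronglyMeasurable
      (fun z : (ℝ × UnitAddTorus d) × EuclideanSpace ℝ d => u z.1.1 (z.1.2 + FunctionSpaces.Torus.proj z.2) - u z.1.1 z.1.2)
      (((volume.restrict (Ioo 0 T)).prod volume).prod ν) :=
  (aestronglyMeasurable_translate (ν := ν) hu FunctionSpaces.Torus.measurable_proj).sub hu.comp_fst

/-- The ball average `(t, x) ↦ ⨍_{B} u t (x + proj y) dy` of a jointly measurable field is
jointly a.e.-strongly measurable (a parametric Bochner integral). [folklore] -/
theorem aestronglyMeasurable_ballAverage
    (hu : AEStronglyMeasurable (uncurry u) ((volume.restrict (Ioo 0 T)).prod volume))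
    (s : Set (EuclideanSpace ℝ d)) :
    AEStronglyMeasurable
      (fun p : ℝ × UnitAddTorus d => ⨍ y in s, u p.1 (p.2 + FunctionSpaces.Torus.proj y))
      ((volume.restrict (Ioo 0 T)).prod volume) := by
  have hT := aestronglyMeasurable_translate (ν := volume.restrict s) hu
    FunctionSpaces.Torus.measurable_proj
  refine ((hT.integral_prod_right').const_smul (volume.real s)⁻¹).congr (ae_of_all _ fun p => ?_)
  simp only [Pi.smul_apply]
  rw [setAverage_eq]

/-- **Ball averages are bounded in `L^q((0,T) × T^d)`** (Young/Jensen for the normalised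
indicator of the ball): `∫₀ᵀ∫ ‖⨍_{B_ℓ} u(t, x + y) dy‖^q ≤ ∫₀ᵀ∫ ‖u‖^q` for `ℓ > 0`, `q ≥ 1`,
in product form. [folklore] -/
theorem lintegral_ballAverage_rpow_le [Nonempty d] {q : ℝ} (hq : 1 ≤ q)
    (hu : AEStronglyMeasurable (uncurry u) ((volume.restrict (Ioo 0 T)).prod volume))
    {ℓ : ℝ} (hℓ : 0 < ℓ) :
    ∫⁻ p, ‖⨍ y in ball (0 : EuclideanSpace ℝ d) ℓ, u p.1 (p.2 + FunctionSpaces.Torus.proj y)‖ₑ ^ q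
        ∂((volume.restrict (Ioo 0 T)).prod volume) ≤
      ∫⁻ p, ‖uncurry u p‖ₑ ^ q ∂((volume.restrict (Ioo 0 T)).prod volume) := by
  set μp : Measure (ℝ × UnitAddTorus d) := (volume.restrict (Ioo 0 T)).prod volume with hμp
  set B : Set (EuclideanSpace ℝ d) := ball 0 ℓ with hB
  have hB0 : volume B ≠ 0 := (measure_ball_pos volume _ hℓ).ne'
  have hBtop : volume B ≠ ∞ := measure_ball_lt_top.ne
  set ν : Measure (EuclideanSpace ℝ d) := volume.restrict B with hν
  have hT := aestronglyMeasurable_translate (ν := ν) hu FunctionSpaces.Torus.measurable_proj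
  -- pointwise Jensen for a.e. `p`
  have hpt : ∀ᵐ p ∂μp, ‖⨍ y in B, u p.1 (p.2 + FunctionSpaces.Torus.proj y)‖ₑ ^ q ≤
      (volume B)⁻¹ * ∫⁻ y, ‖u p.1 (p.2 + FunctionSpaces.Torus.proj y)‖ₑ ^ q ∂ν := by
    filter_upwards [hT.prodMk_left] with p hp
    exact enorm_setAverage_rpow_le hB0 hBtop hp hq
  -- integrate, swap, translation invariance
  have hinv : ∀ y, ∫⁻ p, ‖u p.1 (p.2 + FunctionSpaces.Torus.proj y)‖ₑ ^ q ∂μp =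
      ∫⁻ p, ‖uncurry u p‖ₑ ^ q ∂μp := fun y => by
    have h : MeasurePreserving (Prod.map id fun x : UnitAddTorus d => x + FunctionSpaces.Torus.proj y)
        μp μp := (MeasurePreserving.id _).prod (measurePreserving_add_right volume _)
    have hemb : MeasurableEmbedding (Prod.map id fun x : UnitAddTorus d => x + FunctionSpaces.Torus.proj y) :=
      (MeasurableEquiv.prodCongr (MeasurableEquiv.refl ℝ)
        (MeasurableEquiv.addRight (FunctionSpaces.Torus.proj y))).measurableEmbedding
    exact h.lintegral_comp_emb hemb (fun p => ‖uncurry u p‖ₑ ^ q)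
  calc ∫⁻ p, ‖⨍ y in B, u p.1 (p.2 + FunctionSpaces.Torus.proj y)‖ₑ ^ q ∂μp
      ≤ ∫⁻ p, (volume B)⁻¹ * ∫⁻ y, ‖u p.1 (p.2 + FunctionSpaces.Torus.proj y)‖ₑ ^ q ∂ν ∂μp :=
        lintegral_mono_ae hpt
    _ = (volume B)⁻¹ * ∫⁻ y, ∫⁻ p, ‖u p.1 (p.2 + FunctionSpaces.Torus.proj y)‖ₑ ^ q ∂μp ∂ν := by
        rw [lintegral_const_mul'' _ ((hT.enorm.pow_const q).lintegral_prod_right'),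
          lintegral_lintegral_swap (hT.enorm.pow_const q)]
    _ = ∫⁻ p, ‖uncurry u p‖ₑ ^ q ∂μp := by
        simp only [hinv]
        rw [lintegral_const, hν, Measure.restrict_apply_univ, mul_comm _ (volume B), ← mul_assoc,
          ENNReal.inv_mul_cancel hB0 hBtop, one_mul]

/-- **Ball averages converge in `L^q((0,T) × T^d)`** (Lebesgue's differentiation theorem in the
mean; Folland, *Real Analysis*, Thm. 8.14 (a), for the normalised indicator of the ball): for a
jointly measurable field `u` with `∫₀ᵀ∫ ‖u‖^q < ∞`, `1 ≤ q`,
`∫₀ᵀ∫ ‖⨍_{B_ℓ} u(t, x + y) dy − u(t, x)‖^q dx dt → 0` as `ℓ → 0⁺`, the separation `y ∈ ℝ^d`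
acting through the covering map: Jensen on each ball, Tonelli, and the continuity of
translation `tendsto_lintegral_translate_sub` (`‖proj y‖ ≤ ‖y‖ < ℓ`). [cite: Folland1999, Thm. 8.14 (a)] -/
theorem tendsto_lintegral_ballAverage_sub [CompleteSpace F] [Nonempty d] {q : ℝ} (hq : 1 ≤ q)
    (hu : AEStronglyMeasurable (uncurry u) ((volume.restrict (Ioo 0 T)).prod volume))
    (huq : ∫⁻ t in Ioo 0 T, ∫⁻ x, ‖u t x‖ₑ ^ q < ∞) :
    Tendsto (fun ℓ : ℝ => ∫⁻ t in Ioo 0 T, ∫⁻ x,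
        ‖(⨍ y in ball (0 : EuclideanSpace ℝ d) ℓ, u t (x + FunctionSpaces.Torus.proj y)) - u t x‖ₑ ^ q) (𝓝[>] 0) (𝓝 0) := by
  have hq0 : 0 < q := one_pos.trans_le hq
  set μp : Measure (ℝ × UnitAddTorus d) := (volume.restrict (Ioo 0 T)).prod volume with hμp
  -- the translation modulus in product form
  set Φ : UnitAddTorus d → ℝ≥0∞ := fun h => ∫⁻ p, ‖u p.1 (p.2 + h) - u p.1 p.2‖ₑ ^ q ∂μp with hΦ
  have hΦiter : ∀ h, ∫⁻ t in Ioo 0 T, ∫⁻ x, ‖u t (x + h) - u t x‖ₑ ^ q = Φ h := fun h => by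
    have hm : AEStronglyMeasurable (uncurry fun t x => u t (x + h) - u t x) μp :=
      (aestronglyMeasurable_uncurry_comp_add hu h).sub hu
    rw [hΦ]
    exact (lintegral_prod _ (hm.enorm.pow_const q)).symm
  have hΦlim : Tendsto Φ (𝓝 0) (𝓝 0) := by
    refine (tendsto_lintegral_translate_sub hq hu huq).congr fun h => hΦiter h
  rw [ENNReal.tendsto_nhds_zero]
  intro ε hε
  -- `Φ h ≤ ε` for `‖h‖ < δ`
  obtain ⟨δ, hδ, hΦε⟩ : ∃ δ > 0, ∀ h : UnitAddTorus d, ‖h‖ < δ → Φ h ≤ ε := by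
    have hev : ∀ᶠ h in 𝓝 (0 : UnitAddTorus d), Φ h ≤ ε :=
      (ENNReal.tendsto_nhds_zero.1 hΦlim) ε hε
    obtain ⟨δ, hδ, hball⟩ := Metric.eventually_nhds_iff_ball.1 hev
    exact ⟨δ, hδ, fun h hh => hball h (by simpa [dist_zero_right] using hh)⟩
  filter_upwards [Ioo_mem_nhdsGT hδ] with ℓ hℓ
  set B : Set (EuclideanSpace ℝ d) := ball 0 ℓ with hB
  have hB0 : volume B ≠ 0 := (measure_ball_pos volume _ hℓ.1).ne'
  have hBtop : volume B ≠ ∞ := measure_ball_lt_top.ne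
  set ν : Measure (EuclideanSpace ℝ d) := volume.restrict B with hν
  haveI : IsFiniteMeasure ν := ⟨by rw [hν, Measure.restrict_apply_univ]; exact measure_ball_lt_top⟩
  -- the increment field on the triple product
  set G : (ℝ × UnitAddTorus d) × EuclideanSpace ℝ d → F :=
    fun z => u z.1.1 (z.1.2 + FunctionSpaces.Torus.proj z.2) - u z.1.1 z.1.2 with hG
  have hGm : AEStronglyMeasurable G (μp.prod ν) := aestronglyMeasurable_increment_proj ν hu
  -- Step 1: pointwise Jensen, for a.e. `p = (t, x)`
  have hsec : ∀ᵐ p ∂μp, AEStronglyMeasurable (fun y => G (p, y)) ν := hGm.prodMk_left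
  have hint : ∀ᵐ p ∂μp, Integrable (fun y => u p.1 (p.2 + FunctionSpaces.Torus.proj y)) ν := by
    -- `∫_{μp} ∫⁻_B ‖u(t, x + proj y)‖ dy = |B| ‖u‖₁ < ∞`
    have hT := aestronglyMeasurable_translate (ν := ν) hu FunctionSpaces.Torus.measurable_proj
    have hfin : ∫⁻ z, ‖u z.1.1 (z.1.2 + FunctionSpaces.Torus.proj z.2)‖ₑ ∂(μp.prod ν) < ∞ := by
      have h1 := lintegral_mul_translate_enorm_pow (ν := ν) hu FunctionSpaces.Torus.measurable_proj
        (w := fun _ => 1) aemeasurable_const 1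
      simp only [one_mul, pow_one, lintegral_const] at h1
      rw [h1]
      refine ENNReal.mul_lt_top (by rw [hν, Measure.restrict_apply_univ]; exact measure_ball_lt_top) ?_
      -- `‖u‖₁ < ∞` from `‖u‖_q < ∞` on the finite measure space `μp`
      haveI : IsFiniteMeasure μp := by rw [hμp]; infer_instance
      have hmem : MemLp (uncurry u) (ENNReal.ofReal q) μp := by
        refine ⟨hu, ?_⟩
        rw [← ENNReal.rpow_lt_top_iff_of_pos hq0, ← lintegral_enorm_rpow_eq_eLpNorm_rpow hq0, hμp,
          lintegral_prod _ (hu.enorm.pow_const q)]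
        exact huq
      have h1' : (1 : ℝ≥0∞) ≤ ENNReal.ofReal q := by
        rw [← ENNReal.ofReal_one]; exact ENNReal.ofReal_le_ofReal hq
      have := (hmem.mono_exponent h1').2
      rwa [eLpNorm_one_eq_lintegral_enorm] at this
    have hsecfin : ∀ᵐ p ∂μp, ∫⁻ y, ‖u p.1 (p.2 + FunctionSpaces.Torus.proj y)‖ₑ ∂ν < ∞ :=
      ae_lt_top' (hT.enorm.lintegral_prod_right') (by rw [lintegral_prod _ hT.enorm] at hfin; exact hfin.ne)
    filter_upwards [hT.prodMk_left, hsecfin] with p hp hpf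
    exact ⟨hp, hpf⟩
  have hpt : ∀ᵐ p ∂μp, ‖(⨍ y in B, u p.1 (p.2 + FunctionSpaces.Torus.proj y)) - u p.1 p.2‖ₑ ^ q ≤
      (volume B)⁻¹ * ∫⁻ y, ‖G (p, y)‖ₑ ^ q ∂ν := by
    filter_upwards [hsec, hint] with p hp hpi
    have havg : (⨍ y in B, u p.1 (p.2 + FunctionSpaces.Torus.proj y)) - u p.1 p.2 = ⨍ y in B, G (p, y) := by
      have hc : IntegrableOn (fun _ : EuclideanSpace ℝ d => u p.1 p.2) B volume := integrableOn_const hBtop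
      rw [hG]
      simp only
      rw [setAverage_eq, setAverage_eq, integral_sub hpi hc, smul_sub, setIntegral_const, smul_smul,
        measureReal_def, inv_mul_cancel₀ (ENNReal.toReal_ne_zero.mpr ⟨hB0, hBtop⟩), one_smul]
    rw [havg]
    exact enorm_setAverage_rpow_le hB0 hBtop hp hq
  -- Step 2: integrate and swap (Tonelli)
  have hmain : ∫⁻ p, ‖(⨍ y in B, u p.1 (p.2 + FunctionSpaces.Torus.proj y)) - u p.1 p.2‖ₑ ^ q ∂μp ≤ ε := by
    calc ∫⁻ p, ‖(⨍ y in B, u p.1 (p.2 + FunctionSpaces.Torus.proj y)) - u p.1 p.2‖ₑ ^ q ∂μp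
        ≤ ∫⁻ p, (volume B)⁻¹ * ∫⁻ y, ‖G (p, y)‖ₑ ^ q ∂ν ∂μp := lintegral_mono_ae hpt
      _ = (volume B)⁻¹ * ∫⁻ y, ∫⁻ p, ‖G (p, y)‖ₑ ^ q ∂μp ∂ν := by
          rw [lintegral_const_mul'' _ ((hGm.enorm.pow_const q).lintegral_prod_right'),
            lintegral_lintegral_swap (hGm.enorm.pow_const q)]
      _ ≤ (volume B)⁻¹ * ∫⁻ _y, ε ∂ν := by
          refine mul_le_mul' le_rfl (lintegral_mono_ae ?_)
          filter_upwards [(ae_restrict_mem measurableSet_ball : ∀ᵐ y ∂ν, y ∈ B)] with y hy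
          have hy' : ‖FunctionSpaces.Torus.proj y‖ < δ :=
            (FunctionSpaces.Torus.norm_proj_le y).trans_lt ((mem_ball_zero_iff.1 hy).trans hℓ.2)
          have hGy : ∫⁻ p, ‖G (p, y)‖ₑ ^ q ∂μp = Φ (FunctionSpaces.Torus.proj y) := by
            rw [hΦ, hG]
          rw [hGy]
          exact hΦε (FunctionSpaces.Torus.proj y) hy'
      _ = ε := by
          rw [lintegral_const, hν, Measure.restrict_apply_univ, mul_comm ε (volume B), ← mul_assoc,
            ENNReal.inv_mul_cancel hB0 hBtop, one_mul]
  -- iterated form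
  have hAm : AEStronglyMeasurable
      (uncurry fun t x => (⨍ y in B, u t (x + FunctionSpaces.Torus.proj y)) - u t x) μp :=
    (aestronglyMeasurable_ballAverage hu B).sub hu
  have hprod : ∫⁻ t in Ioo 0 T, ∫⁻ x, ‖(⨍ y in B, u t (x + FunctionSpaces.Torus.proj y)) - u t x‖ₑ ^ q =
      ∫⁻ p, ‖(⨍ y in B, u p.1 (p.2 + FunctionSpaces.Torus.proj y)) - u p.1 p.2‖ₑ ^ q ∂μp :=
    (lintegral_prod (fun p : ℝ × UnitAddTorus d =>
      ‖(⨍ y in B, u p.1 (p.2 + FunctionSpaces.Torus.proj y)) - u p.1 p.2‖ₑ ^ q) (hAm.enorm.pow_const q)).symm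
  rw [hprod]
  exact hmain

/-- `L^q` convergence of ball averages, `eLpNorm` form on the product `(0,T) × T^d`:
`‖⨍_{B_ℓ} u(·, · + y) dy − u‖_{L^q((0,T) × T^d)} → 0` as `ℓ → 0⁺` (`1 ≤ q`). [folklore] -/
theorem tendsto_eLpNorm_ballAverage_sub [CompleteSpace F] [Nonempty d] {q : ℝ} (hq : 1 ≤ q)
    (hu : AEStronglyMeasurable (uncurry u) ((volume.restrict (Ioo 0 T)).prod volume))
    (huq : ∫⁻ t in Ioo 0 T, ∫⁻ x, ‖u t x‖ₑ ^ q < ∞) :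
    Tendsto (fun ℓ : ℝ => eLpNorm
        (uncurry fun t x => (⨍ y in ball (0 : EuclideanSpace ℝ d) ℓ, u t (x + FunctionSpaces.Torus.proj y)) - u t x)
        (ENNReal.ofReal q) ((volume.restrict (Ioo 0 T)).prod volume)) (𝓝[>] 0) (𝓝 0) := by
  have hq0 : 0 < q := one_pos.trans_le hq
  have hlim := tendsto_lintegral_ballAverage_sub hq hu huq
  have hpow := ((ENNReal.continuous_rpow_const (y := 1 / q)).tendsto 0).comp hlim
  rw [ENNReal.zero_rpow_of_pos (by positivity)] at hpow
  refine hpow.congr fun ℓ => ?_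
  have hm : AEStronglyMeasurable
      (uncurry fun t x => (⨍ y in ball (0 : EuclideanSpace ℝ d) ℓ, u t (x + FunctionSpaces.Torus.proj y)) - u t x)
      ((volume.restrict (Ioo 0 T)).prod volume) :=
    (aestronglyMeasurable_ballAverage hu _).sub hu
  simp only [Function.comp_def]
  have hprod : ∫⁻ t in Ioo 0 T, ∫⁻ x,
      ‖(⨍ y in ball (0 : EuclideanSpace ℝ d) ℓ, u t (x + FunctionSpaces.Torus.proj y)) - u t x‖ₑ ^ q =
      ∫⁻ z, ‖uncurry (fun t x =>
        (⨍ y in ball (0 : EuclideanSpace ℝ d) ℓ, u t (x + FunctionSpaces.Torus.proj y)) - u t x) z‖ₑ ^ q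
        ∂((volume.restrict (Ioo 0 T)).prod volume) :=
    (lintegral_prod _ (hm.enorm.pow_const q)).symm
  rw [hprod, lintegral_enorm_rpow_eq_eLpNorm_rpow hq0, ← ENNReal.rpow_mul, mul_one_div_cancel hq0.ne',
    ENNReal.rpow_one]

end BallAverage

end Literature.Analysis.FluidPDE.Torus
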